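import Literature.AlgebraicGeometry.Motives.AlgPointsProductProofs
import Literature.AlgebraicGeometry.Motives.AlgPointsProperMapProofs
import Literature.NumberTheory.Transcendental.AnalytificationSecondCountableProofs
import Literature.NumberTheory.Transcendental.AnalytificationSeparatedProofs
import Literature.Topology.ProperLocalHomeomorph
import Mathlib.RingTheory.Unramified.LocalStructure
import Mathlib.AlgebraicGeometry.Morphisms.Etale
import Mathlib.AlgebraicGeometry.Morphisms.Finite
import Mathlib.Topology.ContinuousMap.Units
import Mathlib.Topology.Covering.Basic
import Mathlib.Topology.IsLocalHomeomorph
import Mathlib.Analysis.Calculus.ImplicitFunction.ProdDomain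
import Mathlib.Analysis.Calculus.ContDiff.RCLike
import Mathlib.Analysis.Calculus.ContDiff.Operations
import Mathlib.Analysis.Calculus.Deriv.Polynomial
import Mathlib.Algebra.Polynomial.OfFn
import Mathlib.Analysis.Complex.Basic
import HarnessLib

/-!
# `f(ℂ)` is a local homeomorphism for `f` ÉTALE — arbitrary (singular) `ℂ`-schemes

Topic `Literature/AlgebraicGeometry/FundamentalGroup`; fourth proof file (theorems only, no
definitions, no named facts) attached to the named fact `riemannExistence_finiteCovering`
(`RiemannExistenceCovering.lean`, SGA 1 XII Thm. 5.1). It supplies the point-set content of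
**SGA 1 XII Prop. 3.1 (iii)** («`f` étale ⇔ `f^an` étale», i.e. `f^an` is a local isomorphism of
analytic spaces) in the direction `⇒` and WITHOUT ANY SMOOTHNESS HYPOTHESIS on `X` or `Y`:

* `exists_openPartialHomeomorph_eqOn_map_of_etale`, `isLocalHomeomorph_map_of_etale`: for a
  `ℂ`-morphism `f : X ⟶ Y` of `ℂ`-schemes with `f` étale, the map of complex points
  `f(ℂ) : X(ℂ) → Y(ℂ)` is a local homeomorphism for the strong (analytic) topologies
  (`Motives.AlgPoints.instTopologicalSpace`); hence open and locally injective
  (`isOpenMap_map_of_etale`, `isLocallyInjective_map_of_etale`);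
* `isCoveringMap_map_of_etale`, `finite_preimage_map_singleton_of_etale`,
  `isCoveringMap_map_of_isFinite_of_etale`: for `f` moreover universally closed and quasi-compact
  (e.g. FINITE ÉTALE) and `X` separated over `ℂ`, `f(ℂ)` is a finite-sheeted covering map — the
  easy direction of Riemann's existence theorem (SGA 1 XII 5.1 with 3.1 (iii), 3.2 (vi): the
  functor `X' ↦ X'^an` lands in finite étale covers of `X^an`), previously in the tree only for
  `X`, `Y` SMOOTH of the same dimension
  (`Motives.ComplexPoints.isCoveringMap_map_of_isFinite`, holomorphic inverse function theorem in
  charts). Part 2 of the proof of XII 5.1 needs it for the normal (singular) schemes produced by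
  its reductions, and its final identification `S'(ℂ) ≃ₜ T` uses that `S'(ℂ) → S(ℂ)` is a
  covering map for the algebraisation `S'` of `T`.

## Proof

SGA 1 derives 3.1 (iii) from the comparison of completed local rings `𝒪̂_{X,φ(x)} ≅ 𝒪̂_{X^an,x}`
(XII Thm. 1.1) and EGA IV 17.4.4; that `f^an` étale means «local isomorphism» is then the analytic
inverse function theorem. The tree's carrier `X(ℂ)` has no analytic structure sheaf for singular
`X`, so we unwind this into its point-set content: locally an étale morphism is a STANDARD étale
one (SGA 1 Exp. I Thm. 7.6 = Mathlib's local structure theorem), i.e. cut out of `U × 𝔸¹` by one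
monic equation `F(t) = 0` with `F'(t)` invertible, and a simple root of a polynomial depends
continuously on the coefficients (implicit function theorem):

1. `exists_standardEtalePresentation` — **étale is locally standard étale**: every `P ∈ X(ℂ)` lies
   in an affine open `W ⊆ f⁻¹ U`, `U ⊆ Y` affine, with `Γ(X, W) ≅ Γ(Y, U)[x][y]/(F, yg − 1)`,
   `F` monic, `F'` invertible (Mathlib `Algebra.IsEtaleAt.exists_isStandardEtale` at the maximal
   ideal `ker (a ↦ a(P))`, transported along `Γ(X, W₀)[1/s] ≅ Γ(X, D(s))`).
2. Point-set dictionary of the chart (`eval_map_f_eq_zero`, `eval_map_g_ne_zero`,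
   `eval_map_derivative_f_ne_zero`, `eq_of_map_eq_of_eval_x_eq`): for `P' ∈ W(ℂ)` the value
   `x(P')` is a simple root of `F^{f(P')}` off the zeros of `g^{f(P')}`, and `P'` is determined
   by `(f(P'), x(P'))` (`StandardEtalePresentation.hom_ext`; points of an affine open are
   determined by the values of its functions, `ext_of_eval_eq`).
3. `exists_continuousOn_root` — **continuous selection of a simple root** (the implicit function
   theorem, Mathlib `HasStrictFDerivAt.implicitFunctionDataOfProdDomain`, applied to the generic
   polynomial `(v, t) ↦ ∑ vᵢ tⁱ = (Polynomial.ofFn (d+1) v)(t)` on `ℂ^{d+1} × ℂ`): along any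
   continuous family of coefficient vectors, a simple root moves continuously and is locally the
   unique root near its initial value.
4. `exists_continuous_section` — **continuous roots give continuous sections**: a continuous root
   `x_S ∈ C(S, ℂ)` of `F` along a continuous family `ι : S → U(ℂ)` defines, by the universal
   property of the standard étale algebra with values in the ring `C(S, ℂ)`
   (`StandardEtalePair.lift`), a morphism `Spec C(S, ℂ) → W`, i.e. a family `σ : S → W(ℂ)` with
   `f ∘ σ = ι`, `x ∘ σ = x_S`, which is CONTINUOUS by the tree's device
   `Motives.AlgPoints.continuous_of_family` (families through `Spec C(S, ℂ)` are continuous).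
5. Assembly (`exists_openPartialHomeomorph_eqOn_map_of_etale`): on the open set
   `O = {P' ∈ W(ℂ) | f(P') ∈ N, |x(P') − x(P)| < ε}` the map `f(ℂ)` is a bijection onto the
   open set `N ∋ f(P)` of step 3 with continuous inverse the section of step 4 (injectivity by the
   uniqueness clause of step 3 and step 2).

The covering statements then follow as in `Motives/ComplexPointsFiniteEtaleCovering`: `f(ℂ)` is
proper (`Motives.AlgPoints.isProperMap_map`, SGA 1 XII 3.2 (v)), `X(ℂ)` is Hausdorff
(`Motives.ComplexPoints.t2Space_of_isSeparated`), and a proper local homeomorphism from a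
Hausdorff space is a finite covering (Mathlib `IsClosedMap.isCoveringMapOn_of_isLocalHomeomorphOn`).

## References

* [SGA1] A. Grothendieck, M. Raynaud, *SGA 1* (LNM 224 / arXiv:math/0206203), Exp. XII
  Prop. 3.1 (iii) (p. 321 of the SMF edition; p0180 of the materialised text), Prop. 3.2 (v)–(vi)
  (p. 323), Thm. 5.1 (p. 333; p0184); Exp. I Thm. 7.6 (local structure of étale morphisms:
  `𝒪 ≅ (A[t]/F A[t])_𝔫`, `F'(u) ∉ 𝔫`; p0015).
* [SerreGAGA1956] J.-P. Serre, *Géométrie algébrique et géométrie analytique*, Ann. Inst.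
  Fourier 6 (1956), §2 n°5 Lemme 1, Prop. 2.
* [Forster1981] O. Forster, *Lectures on Riemann Surfaces*, GTM 81, §4.21–4.22 (proper local
  homeomorphisms are finite coverings).

#harness_tags algebraic_geometry.gaga, topology.local_homeomorphism, topology.covering_map
-/

noncomputable section

open CategoryTheory AlgebraicGeometry Set
open scoped Polynomial ContDiff
open _root_.Topology _root_.TopologicalSpace

namespace Literature.AlgebraicGeometry.FundamentalGroup

open Literature.AlgebraicGeometry.Motives Literature.AlgebraicGeometry.Motives.AlgPoints
open Literature.NumberTheory.Transcendental

/-! ### Continuous selection of a simple root (implicit function theorem) -/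

section SimpleRoot

/-- Evaluation of the polynomial `Polynomial.ofFn (d+1) v = ∑ᵢ vᵢ Xⁱ` with coefficient vector
`v ∈ ℂ^{d+1}` is the finite sum `∑ᵢ vᵢ tⁱ`. [folklore] -/
theorem eval_ofFn {d : ℕ} (v : Fin (d + 1) → ℂ) (t : ℂ) :
    (Polynomial.ofFn (d + 1) v).eval t = ∑ i : Fin (d + 1), v i * t ^ (i : ℕ) := by
  rw [Polynomial.ofFn_eq_sum_monomial, Polynomial.eval_finsetSum]
  simp only [Polynomial.eval_monomial]

/-- The evaluation map `(v, t) ↦ ∑ᵢ vᵢ tⁱ` of the generic polynomial of degree `≤ d` on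
`ℂ^{d+1} × ℂ` is holomorphic (a polynomial map). [folklore] -/
theorem contDiff_eval_ofFn (d : ℕ) :
    ContDiff ℂ ω fun q : (Fin (d + 1) → ℂ) × ℂ ↦ (Polynomial.ofFn (d + 1) q.1).eval q.2 := by
  have heq : (fun q : (Fin (d + 1) → ℂ) × ℂ ↦ (Polynomial.ofFn (d + 1) q.1).eval q.2) =
      fun q ↦ ∑ i : Fin (d + 1), q.1 i * q.2 ^ (i : ℕ) :=
    funext fun q ↦ eval_ofFn q.1 q.2
  rw [heq]
  exact ContDiff.sum fun i _ ↦ ((contDiff_apply ℂ ℂ i).comp contDiff_fst).mul (contDiff_snd.pow _)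

/-- Multiplication by a non-zero scalar is an invertible continuous linear map `ℂ →L[ℂ] ℂ`.
[folklore] -/
theorem isInvertible_smulRight_one {c : ℂ} (hc : c ≠ 0) :
    (ContinuousLinearMap.smulRight (1 : ℂ →L[ℂ] ℂ) c).IsInvertible := by
  refine ⟨ContinuousLinearEquiv.unitsEquivAut ℂ (Units.mk0 c hc), ?_⟩
  ext
  simp

/-- **Continuous selection of a simple root** (implicit function theorem). Let `cv : N → ℂ^{d+1}`
be continuous on an open set `N₀ ∋ n₀` (coefficient vectors of a family of polynomials
`Polynomial.ofFn (d+1) (cv n)` of degree `≤ d` parametrised by a topological space `N`), and `t₀` a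
SIMPLE root of the polynomial with coefficients `cv n₀`. Then on an open neighbourhood `N' ⊆ N₀` of
`n₀` there is a continuous function `τ` with `τ n₀ = t₀` such that `τ n` is a root of the
polynomial with coefficients `cv n`, and it is the ONLY root of that polynomial in a fixed disc
around `t₀`. Proof: Mathlib's implicit function theorem on a product domain
(`HasStrictFDerivAt.implicitFunctionDataOfProdDomain`) for `(v, t) ↦ ∑ vᵢ tⁱ : ℂ^{d+1} × ℂ → ℂ` at
`(cv n₀, t₀)`, whose partial derivative in `t` is the non-zero scalar `(∑ vᵢ Xⁱ)'(t₀)`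
(`Polynomial.hasDerivAt`), gives a partial homeomorphism `(v, t) ↦ (∑ vᵢ tⁱ, v)`; its inverse on
`{0} × (nbhd of cv n₀)` is the continuous root, unique in the source.
(The implicit function theorem behind «`f` étale ⇒ `f^an` étale = local isomorphism»,
SGA 1 XII Prop. 3.1 (iii).) [folklore] -/
theorem exists_continuousOn_root {N : Type*} [TopologicalSpace N] {d : ℕ}
    (cv : N → (Fin (d + 1) → ℂ)) {N₀ : Set N} (hN₀ : IsOpen N₀) {n₀ : N} (hn₀ : n₀ ∈ N₀)
    (hcv : ContinuousOn cv N₀) {t₀ : ℂ} (h0 : (Polynomial.ofFn (d + 1) (cv n₀)).eval t₀ = 0)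
    (h1 : (Polynomial.ofFn (d + 1) (cv n₀)).derivative.eval t₀ ≠ 0) :
    ∃ N' : Set N, IsOpen N' ∧ n₀ ∈ N' ∧ N' ⊆ N₀ ∧ ∃ τ : N → ℂ, ContinuousOn τ N' ∧ τ n₀ = t₀ ∧
      (∀ n ∈ N', (Polynomial.ofFn (d + 1) (cv n)).eval (τ n) = 0) ∧
      ∃ ε > (0 : ℝ), ∀ n ∈ N', ∀ t, dist t t₀ < ε →
        (Polynomial.ofFn (d + 1) (cv n)).eval t = 0 → t = τ n := by
  classical
  -- the generic polynomial `Φ (v, t) = ∑ vᵢ tⁱ`, strictly differentiable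
  set Φ : (Fin (d + 1) → ℂ) × ℂ → ℂ := fun q ↦ (Polynomial.ofFn (d + 1) q.1).eval q.2 with hΦ
  set u : (Fin (d + 1) → ℂ) × ℂ := (cv n₀, t₀) with hu
  have hder : HasStrictFDerivAt Φ (fderiv ℂ Φ u) u :=
    (contDiff_eval_ofFn d).contDiffAt.hasStrictFDerivAt (by simp)
  -- its partial derivative in `t` is multiplication by the derivative of the polynomial
  have hpartial : (fderiv ℂ Φ u).comp (ContinuousLinearMap.inr ℂ (Fin (d + 1) → ℂ) ℂ) =
      ContinuousLinearMap.smulRight (1 : ℂ →L[ℂ] ℂ)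
        ((Polynomial.ofFn (d + 1) (cv n₀)).derivative.eval t₀) := by
    have hc1 : HasFDerivAt (fun s : ℂ ↦ Φ (cv n₀, s))
        ((fderiv ℂ Φ u).comp (ContinuousLinearMap.inr ℂ (Fin (d + 1) → ℂ) ℂ)) t₀ :=
      hder.hasFDerivAt.comp t₀ (hasFDerivAt_prodMk_right (cv n₀) t₀)
    have hc2 : HasFDerivAt (fun s : ℂ ↦ Φ (cv n₀, s)) (ContinuousLinearMap.smulRight
        (1 : ℂ →L[ℂ] ℂ) ((Polynomial.ofFn (d + 1) (cv n₀)).derivative.eval t₀)) t₀ :=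
      ((Polynomial.ofFn (d + 1) (cv n₀)).hasDerivAt t₀).hasFDerivAt
    exact hc1.unique hc2
  have hinv : ((fderiv ℂ Φ u).comp
      (ContinuousLinearMap.inr ℂ (Fin (d + 1) → ℂ) ℂ)).IsInvertible := by
    rw [hpartial]
    exact isInvertible_smulRight_one h1
  -- the implicit function theorem: `e (v, t) = (Φ (v, t), v)` is a partial homeomorphism
  set φ := hder.implicitFunctionDataOfProdDomain hinv with hφ
  set e := φ.toOpenPartialHomeomorph with he
  have he_apply : ∀ q, e q = (Φ q, q.1) := fun q ↦ rfl
  have hu_src : u ∈ e.source := φ.pt_mem_toOpenPartialHomeomorph_source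
  have hu0 : Φ u = 0 := h0
  -- the set of parameters `v` with `(0, v)` in the target, and the root function `ψ`
  set T : Set (Fin (d + 1) → ℂ) := {v | ((0 : ℂ), v) ∈ e.target} with hT
  have hTopen : IsOpen T :=
    e.open_target.preimage (Continuous.prodMk_right (0 : ℂ))
  set ψ : (Fin (d + 1) → ℂ) → ℂ := fun v ↦ (e.symm (0, v)).2 with hψ
  have hψcont : ContinuousOn ψ T := by
    refine continuous_snd.comp_continuousOn (e.continuousOn_symm.comp
      (Continuous.prodMk_right (0 : ℂ)).continuousOn fun v hv ↦ hv)
  -- on `T`, `e.symm (0, v) = (v, ψ v)` is a root in the source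
  have hsymm : ∀ v ∈ T, e.symm (0, v) = (v, ψ v) := by
    intro v hv
    have h := e.right_inv hv
    rw [he_apply] at h
    have h1' : (e.symm (0, v)).1 = v := congrArg Prod.snd h
    exact Prod.ext h1' rfl
  have hroot : ∀ v ∈ T, Φ (v, ψ v) = 0 := by
    intro v hv
    have h := e.right_inv hv
    rw [he_apply, hsymm v hv] at h
    exact congrArg Prod.fst h
  -- uniqueness of the root in the source
  have huniq : ∀ v t, (v, t) ∈ e.source → Φ (v, t) = 0 → v ∈ T ∧ t = ψ v := by
    intro v t hvt hzero
    have him : e (v, t) = (0, v) := by rw [he_apply, hzero]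
    have htgt : ((0 : ℂ), v) ∈ e.target := by rw [← him]; exact e.map_source hvt
    refine ⟨htgt, ?_⟩
    have := e.left_inv hvt
    rw [him, hsymm v htgt] at this
    exact (congrArg Prod.snd this).symm
  -- a product neighbourhood of `u` inside the source
  obtain ⟨δ, hδ, hball⟩ := Metric.isOpen_iff.mp e.open_source u hu_src
  have hu0T : cv n₀ ∈ T ∧ t₀ = ψ (cv n₀) := huniq _ _ hu_src hu0
  -- the neighbourhood of `n₀`
  refine ⟨N₀ ∩ cv ⁻¹' (T ∩ Metric.ball (cv n₀) δ), hcv.isOpen_inter_preimage hN₀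
    (hTopen.inter Metric.isOpen_ball), ⟨hn₀, hu0T.1, Metric.mem_ball_self hδ⟩,
    inter_subset_left, ψ ∘ cv, ?_, ?_, ?_, δ, hδ, ?_⟩
  · refine hψcont.comp (hcv.mono inter_subset_left) ?_
    rintro n ⟨-, hnT, -⟩
    exact hnT
  · exact hu0T.2.symm
  · rintro n ⟨-, hnT, -⟩
    exact hroot _ hnT
  · rintro n ⟨-, -, hnball⟩ t ht hzero
    have hmem : (cv n, t) ∈ e.source := by
      refine hball ?_
      rw [Metric.mem_ball, Prod.dist_eq, hu]
      exact max_lt hnball ht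
    exact (huniq _ _ hmem hzero).2

end SimpleRoot

variable {X Y : Motives.SchemeOver ℂ} (f : X ⟶ Y)

/-! ### Points of an affine open are determined by the values of its regular functions -/

/-- Two `L`-points lying in an affine open `U` with the same values on `Γ(X, U)` are equal
(`U(L) = Hom(Γ(X, U), L)`, injectivity; `AlgPoints.specMap_evalRingHom_fromSpec`). [folklore] -/
theorem ext_of_eval_eq {k : Type} [Field k] {Z : Motives.SchemeOver k} {L : Type} [Field L]
    [Algebra k L] {U : Z.left.Opens} (hU : IsAffineOpen U) {P Q : AlgPoints Z L} (hP : P.pt ∈ U)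
    (hQ : Q.pt ∈ U) (h : ∀ a, P.eval U hP a = Q.eval U hQ a) : P = Q := by
  have hev : P.evalRingHom U hP = Q.evalRingHom U hQ := RingHom.ext h
  have h1 := specMap_evalRingHom_fromSpec P hU hP
  rw [hev, specMap_evalRingHom_fromSpec Q hU hQ] at h1
  exact Over.OverMorphism.ext h1.symm

/-! ### An affine chart `W → U` of `f` and its coordinate ring as a `Γ(Y, U)`-algebra -/

section Chart

variable {U : Y.left.Opens} {W : X.left.Opens} (e : W ≤ f.left ⁻¹ᵁ U)

/-- `r(f(P)) = (f^* r)(P)` for `r ∈ Γ(Y, U)` and `P ∈ W(ℂ)`, `W ⊆ f⁻¹ U`. [folklore] -/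
theorem eval_map_eq_eval_appLE {P : Motives.ComplexPoints X} (hP : P.pt ∈ W) (r : Γ(Y.left, U)) :
    (map f P).eval U (e hP) r = P.eval W hP (f.left.appLE U W e r) := by
  rw [eval_map]
  change _ = P.eval W hP ((f.left.app U ≫ X.left.presheaf.map (homOfLE e).op) r)
  rw [CategoryTheory.comp_apply, eval_map_homOfLE]

/-- The structure map `ℂ → Γ(X, W)` factors through `f^* : Γ(Y, U) → Γ(X, W)` (as `f` is a
morphism over `Spec ℂ`). [folklore] -/
theorem appLE_top_eq (c : Γ(Spec (CommRingCat.of ℂ), ⊤)) :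
    X.hom.appLE ⊤ W le_top c = f.left.appLE U W e (Y.hom.appLE ⊤ U le_top c) := by
  have key : ∀ (g : X.left ⟶ Spec (CommRingCat.of ℂ)) (hg : g = f.left ≫ Y.hom),
      g.appLE ⊤ W le_top c = f.left.appLE U W e (Y.hom.appLE ⊤ U le_top c) := by
    rintro _ rfl
    rw [← CategoryTheory.comp_apply, Scheme.Hom.appLE_comp_appLE]
  exact key _ (Over.w f).symm

variable [Algebra Γ(Y.left, U) Γ(X.left, W)]
  (halg : ∀ r, algebraMap Γ(Y.left, U) Γ(X.left, W) r = f.left.appLE U W e r)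

include halg in
/-- Evaluation at `P ∈ W(ℂ)` restricted to `Γ(Y, U)` is evaluation at `f(P)`. [folklore] -/
theorem evalRingHom_comp_algebraMap {P : Motives.ComplexPoints X} (hP : P.pt ∈ W) :
    (P.evalRingHom W hP).comp (algebraMap Γ(Y.left, U) Γ(X.left, W)) =
      (map f P).evalRingHom U (e hP) :=
  RingHom.ext fun r ↦ by
    rw [RingHom.comp_apply, halg, evalRingHom_apply, evalRingHom_apply, eval_map_eq_eval_appLE]

variable (Pr : StandardEtalePresentation Γ(Y.left, U) Γ(X.left, W))

include halg in
/-- For `P ∈ W(ℂ)`, a polynomial `p` over `Γ(Y, U)` evaluated at the generator `x` of the standard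
étale presentation takes at `P` the value `p^{f(P)}(x(P))`. [folklore] -/
theorem eval_aeval_x {P : Motives.ComplexPoints X} (hP : P.pt ∈ W) (p : Γ(Y.left, U)[X]) :
    P.eval W hP (Polynomial.aeval Pr.x p) =
      (p.map ((map f P).evalRingHom U (e hP))).eval (P.eval W hP Pr.x) := by
  rw [← evalRingHom_apply, Polynomial.aeval_def, Polynomial.hom_eval₂,
    evalRingHom_comp_algebraMap f e halg, Polynomial.eval_map, evalRingHom_apply]

include halg in
/-- `x(P)` is a root of `F^{f(P)}`, `F` the monic polynomial of the presentation. [folklore] -/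
theorem eval_map_f_eq_zero {P : Motives.ComplexPoints X} (hP : P.pt ∈ W) :
    (Pr.f.map ((map f P).evalRingHom U (e hP))).eval (P.eval W hP Pr.x) = 0 := by
  rw [← eval_aeval_x f e halg Pr hP, Pr.hasMap.1, ← evalRingHom_apply, map_zero]

include halg in
/-- `g^{f(P)}(x(P)) ≠ 0`, `g` the localising polynomial of the presentation. [folklore] -/
theorem eval_map_g_ne_zero {P : Motives.ComplexPoints X} (hP : P.pt ∈ W) :
    (Pr.g.map ((map f P).evalRingHom U (e hP))).eval (P.eval W hP Pr.x) ≠ 0 := by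
  rw [← eval_aeval_x f e halg Pr hP, ← evalRingHom_apply]
  exact (Pr.hasMap.2.map _).ne_zero

include halg in
/-- `x(P)` is a SIMPLE root of `F^{f(P)}`. [folklore] -/
theorem eval_map_derivative_f_ne_zero {P : Motives.ComplexPoints X} (hP : P.pt ∈ W) :
    (Pr.f.derivative.map ((map f P).evalRingHom U (e hP))).eval (P.eval W hP Pr.x) ≠ 0 := by
  rw [← eval_aeval_x f e halg Pr hP, ← evalRingHom_apply]
  exact (Pr.hasMap.isUnit_derivative_f.map _).ne_zero

include halg in
/-- **Points of a standard-étale chart are determined by `(f(P), x(P))`.** [folklore] -/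
theorem eq_of_map_eq_of_eval_x_eq (hW : IsAffineOpen W) {P P' : Motives.ComplexPoints X}
    (hP : P.pt ∈ W) (hP' : P'.pt ∈ W) (hmap : map f P = map f P')
    (hx : P.eval W hP Pr.x = P'.eval W hP' Pr.x) : P = P' := by
  letI : Algebra Γ(Y.left, U) ℂ := ((map f P).evalRingHom U (e hP)).toAlgebra
  have hc : ∀ (Q : Motives.ComplexPoints X) (hQ : Q.pt ∈ W), map f Q = map f P → ∀ r,
      Q.evalRingHom W hQ (algebraMap Γ(Y.left, U) Γ(X.left, W) r) =
        algebraMap Γ(Y.left, U) ℂ r := by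
    intro Q hQ hQP r
    rw [RingHom.algebraMap_toAlgebra, ← RingHom.comp_apply, evalRingHom_comp_algebraMap f e halg,
      evalRingHom_apply, evalRingHom_apply]
    have key : ∀ (R : Motives.ComplexPoints Y) (hR : R = map f P) (h₁ : R.pt ∈ U),
        R.eval U h₁ r = (map f P).eval U (e hP) r := by
      rintro _ rfl _; rfl
    exact key _ hQP _
  let a₁ : Γ(X.left, W) →ₐ[Γ(Y.left, U)] ℂ :=
    { toRingHom := P.evalRingHom W hP, commutes' := hc P hP rfl }
  let a₂ : Γ(X.left, W) →ₐ[Γ(Y.left, U)] ℂ :=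
    { toRingHom := P'.evalRingHom W hP', commutes' := hc P' hP' hmap.symm }
  have h12 : a₁ = a₂ := Pr.hom_ext hx
  refine ext_of_eval_eq hW hP hP' fun a ↦ ?_
  exact congr($h12 a)

/-! ### Continuous sections of `f(ℂ)` over a standard-étale chart -/

include halg in
/-- **Continuous local sections from continuous roots.** Over a standard-étale chart
`W = Spec Γ(Y,U)[x][y]/(F, yg - 1) → U`, a continuous family `ι : S → U(ℂ)` together with a
continuous choice `x_S : S → ℂ` of a root of `F^{ι(s)}` off the zeros of `g^{ι(s)}` lifts to a
CONTINUOUS family `σ : S → W(ℂ)` with `f ∘ σ = ι` and `x ∘ σ = x_S` (universal property of the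
standard étale algebra with values in `C(S, ℂ)`, `StandardEtalePair.lift`, and continuity of
families through `Spec C(S, ℂ)`, `AlgPoints.continuous_of_family`).
[cite: SGA1, Exp. XII Prop. 3.1 (iii)] [cite: SerreGAGA1956, §2 n°5 Lemme 1] -/
theorem exists_continuous_section (hU : IsAffineOpen U) (hW : IsAffineOpen W)
    {S : Type} [TopologicalSpace S] (ι : S → Motives.ComplexPoints Y) (hι : Continuous ι)
    (hιU : ∀ s, (ι s).pt ∈ U) (xS : C(S, ℂ))
    (hf0 : ∀ s, (Pr.f.map ((ι s).evalRingHom U (hιU s))).eval (xS s) = 0)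
    (hg0 : ∀ s, (Pr.g.map ((ι s).evalRingHom U (hιU s))).eval (xS s) ≠ 0) :
    ∃ σ : S → Motives.ComplexPoints X, Continuous σ ∧ ∃ hσ : ∀ s, (σ s).pt ∈ W,
      (∀ s, map f (σ s) = ι s) ∧ ∀ s, (σ s).eval W (hσ s) Pr.x = xS s := by
  -- `Γ(Y, U) → C(S, ℂ)`, `r ↦ (s ↦ r(ι s))`
  let Φ : Γ(Y.left, U) →+* C(S, ℂ) := familyHom ι hι U hιU
  letI : Algebra Γ(Y.left, U) C(S, ℂ) := Φ.toAlgebra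
  have hΦ : ∀ s, (evalAt ℂ s).comp Φ = (ι s).evalRingHom U (hιU s) := fun s ↦
    RingHom.ext fun r ↦ rfl
  have haeval : ∀ (p : Γ(Y.left, U)[X]) (s : S),
      Polynomial.aeval xS p s = (p.map ((ι s).evalRingHom U (hιU s))).eval (xS s) := by
    intro p s
    rw [← evalAt_apply ℂ s (Polynomial.aeval xS p), Polynomial.aeval_def, Polynomial.hom_eval₂,
      RingHom.algebraMap_toAlgebra, hΦ, Polynomial.eval_map, evalAt_apply]
  -- the universal property of the standard étale algebra
  have hmap : Pr.P.HasMap xS := by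
    refine ⟨ContinuousMap.ext fun s ↦ ?_, (ContinuousMap.isUnit_iff_forall_ne_zero _).mpr
      fun s ↦ ?_⟩
    · rw [haeval, ContinuousMap.zero_apply]
      exact hf0 s
    · rw [haeval]
      exact hg0 s
  let Ψ : Γ(X.left, W) →ₐ[Γ(Y.left, U)] C(S, ℂ) := (Pr.P.lift xS hmap).comp Pr.equivRing.toAlgHom
  have hΨx : Ψ Pr.x = xS := by
    simp [Ψ]
  have hΨalg : ∀ r, Ψ (algebraMap Γ(Y.left, U) Γ(X.left, W) r) = Φ r := fun r ↦ Ψ.commutes r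
  -- the points `σ s`
  have hpt : ∀ s, ∃ P : Motives.ComplexPoints X, ∃ h : P.pt ∈ W,
      ∀ a, P.eval W h a = Ψ a s := by
    intro s
    refine exists_eval_eq hW ((evalAt ℂ s).comp Ψ.toRingHom) (RingHom.ext fun c ↦ ?_)
    change Ψ (X.hom.appLE ⊤ W le_top ((Scheme.ΓSpecIso (.of ℂ)).inv c)) s = algebraMap ℂ ℂ c
    rw [appLE_top_eq f e, ← halg, hΨalg]
    change (ι s).eval U (hιU s) (Y.hom.appLE ⊤ U le_top ((Scheme.ΓSpecIso (.of ℂ)).inv c)) = _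
    rw [eval_appLE_top]
    congr 1
    exact Iso.inv_hom_id_apply _ c
  choose σ hσW hσev using hpt
  refine ⟨σ, ?_, hσW, fun s ↦ ?_, fun s ↦ ?_⟩
  · refine continuous_of_family (Spec.map (CommRingCat.ofHom Ψ.toRingHom) ≫ hW.fromSpec) σ
      fun s ↦ ?_
    rw [← specMap_evalRingHom_fromSpec (σ s) hW (hσW s)]
    have : (σ s).evalRingHom W (hσW s) = (evalAt ℂ s).comp Ψ.toRingHom := RingHom.ext (hσev s)
    rw [this, CommRingCat.ofHom_comp, Spec.map_comp, Category.assoc]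
  · refine ext_of_eval_eq hU (e (hσW s)) (hιU s) fun r ↦ ?_
    rw [eval_map_eq_eval_appLE f e (hσW s), ← halg, hσev, hΨalg]
    rfl
  · rw [hσev, hΨx]

end Chart

/-! ### Existence of standard-étale charts -/

/-- **Étale morphisms are locally standard étale** (Mathlib
`Algebra.IsEtaleAt.exists_isStandardEtale`), in chart form on complex points: every `P ∈ X(ℂ)`
lies in an affine open `W` mapping into an affine open `U ⊆ Y` such that `Γ(X, W)` is a standard
étale `Γ(Y, U)`-algebra `Γ(Y, U)[x][y]/(F, yg - 1)`.
[cite: SGA1, Exp. I Thm. 7.6 and Exp. XII Prop. 3.1 (iii)] -/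
theorem exists_standardEtalePresentation [Etale f.left] (P : Motives.ComplexPoints X) :
    ∃ (U : Y.left.Opens) (_ : IsAffineOpen U) (W : X.left.Opens) (_ : IsAffineOpen W)
      (e : W ≤ f.left ⁻¹ᵁ U), P.pt ∈ W ∧
      letI := (f.left.appLE U W e).hom.toAlgebra
      Nonempty (StandardEtalePresentation Γ(Y.left, U) Γ(X.left, W)) := by
  -- affine opens `U ∋ f(P)` and `W₀ ∋ P` with `W₀ ⊆ f⁻¹ U`
  obtain ⟨_, ⟨U, hU, rfl⟩, hQU, -⟩ := Y.left.isBasis_affineOpens.exists_subset_of_mem_open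
    (Set.mem_univ (map f P).pt) isOpen_univ
  obtain ⟨_, ⟨W₀, hW₀, rfl⟩, hPW₀, hle⟩ := X.left.isBasis_affineOpens.exists_subset_of_mem_open
    (show P.pt ∈ (f.left ⁻¹ᵁ U : X.left.Opens) from hQU) (f.left ⁻¹ᵁ U).isOpen
  replace hle : W₀ ≤ f.left ⁻¹ᵁ U := hle
  -- `Γ(X, W₀)` is an étale `Γ(Y, U)`-algebra
  letI alg₀ : Algebra Γ(Y.left, U) Γ(X.left, W₀) := (f.left.appLE U W₀ hle).hom.toAlgebra
  haveI : Algebra.Etale Γ(Y.left, U) Γ(X.left, W₀) := f.left.etale_appLE hU hW₀ hle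
  -- the maximal ideal of `P`, and a standard étale localisation `Γ(X, W₀)[1/s]`, `s(P) ≠ 0`
  let q : Ideal Γ(X.left, W₀) := RingHom.ker (P.evalRingHom W₀ hPW₀)
  haveI hq : q.IsPrime := RingHom.ker_isPrime _
  obtain ⟨s, hsq, hstd⟩ := Algebra.IsEtaleAt.exists_isStandardEtale (R := Γ(Y.left, U)) q
  have hPs : P.pt ∈ X.left.basicOpen s := by
    rw [← eval_ne_zero_iff_mem_basicOpen P W₀ hPW₀]
    intro h0
    exact hsq (by rwa [RingHom.mem_ker, evalRingHom_apply])
  have hWle : X.left.basicOpen s ≤ f.left ⁻¹ᵁ U := (X.left.basicOpen_le s).trans hle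
  refine ⟨U, hU, X.left.basicOpen s, hW₀.basicOpen s, hWle, hPs, ?_⟩
  -- transfer the standard étale structure along `Γ(X, W₀)[1/s] ≅ Γ(X, D(s))`
  letI alg : Algebra Γ(Y.left, U) Γ(X.left, X.left.basicOpen s) :=
    (f.left.appLE U (X.left.basicOpen s) hWle).hom.toAlgebra
  haveI : IsScalarTower Γ(Y.left, U) Γ(X.left, W₀) Γ(X.left, X.left.basicOpen s) := by
    refine IsScalarTower.of_algebraMap_eq fun r ↦ ?_
    change f.left.appLE U (X.left.basicOpen s) hWle r =
      (X.left.presheaf.map (homOfLE (X.left.basicOpen_le s)).op) (f.left.appLE U W₀ hle r)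
    rw [← CategoryTheory.comp_apply, Scheme.Hom.appLE_map]
  haveI : IsLocalization.Away s Γ(X.left, X.left.basicOpen s) := hW₀.isLocalization_basicOpen s
  let eqv : Localization.Away s ≃ₐ[Γ(Y.left, U)] Γ(X.left, X.left.basicOpen s) :=
    (IsLocalization.algEquiv (Submonoid.powers s) (Localization.Away s)
      Γ(X.left, X.left.basicOpen s)).restrictScalars Γ(Y.left, U)
  haveI := Algebra.IsStandardEtale.of_equiv eqv
  exact Algebra.IsStandardEtale.nonempty_standardEtalePresentation


/-! ### `f(ℂ)` is a local homeomorphism for `f` étale -/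

/-- **`f(ℂ)` is a local homeomorphism at every point for `f` étale** — arbitrary `ℂ`-schemes, no
smoothness: there is a partial homeomorphism `X(ℂ) ⇀ Y(ℂ)` with open source containing `P` and
agreeing with `f(ℂ)` on it. See the module docstring for the five steps.
[cite: SGA1, Exp. XII Prop. 3.1 (iii) (p. 321) and Exp. I Thm. 7.6] -/
theorem exists_openPartialHomeomorph_eqOn_map_of_etale [Etale f.left]
    (P : Motives.ComplexPoints X) :
    ∃ E : OpenPartialHomeomorph (Motives.ComplexPoints X) (Motives.ComplexPoints Y),
      P ∈ E.source ∧ EqOn (map f) E E.source := by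
  classical
  obtain ⟨U, hU, W, hW, e, hPW, hPr⟩ := exists_standardEtalePresentation f P
  letI : Algebra Γ(Y.left, U) Γ(X.left, W) := (f.left.appLE U W e).hom.toAlgebra
  obtain ⟨Pr⟩ := hPr
  have halg : ∀ r, algebraMap Γ(Y.left, U) Γ(X.left, W) r = f.left.appLE U W e r := fun _ ↦ rfl
  -- the image point `Q = f(P)` and the root `t₀ = x(P)`
  set Q : Motives.ComplexPoints Y := map f P with hQ
  have hQU : Q.pt ∈ U := e hPW
  set t₀ : ℂ := P.eval W hPW Pr.x with ht₀
  -- step 3: the coefficient functions of `F` on `U(ℂ)` and the continuous root `τ`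
  set d : ℕ := Pr.f.natDegree with hd
  let cv : Motives.ComplexPoints Y → (Fin (d + 1) → ℂ) := fun R i ↦
    evalOrZero U (Pr.f.coeff (i : ℕ)) R
  have hcv : ContinuousOn cv {R | R.pt ∈ U} :=
    continuousOn_pi.mpr fun i ↦ continuousOn_evalOrZero U _
  have hpolyR : ∀ (R : Motives.ComplexPoints Y) (hR : R.pt ∈ U),
      Polynomial.ofFn (d + 1) (cv R) = Pr.f.map (R.evalRingHom U hR) := by
    intro R hR
    ext n
    rw [Polynomial.coeff_map, evalRingHom_apply]
    by_cases hn : n < d + 1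
    · rw [Polynomial.ofFn_coeff_eq_val_of_lt _ hn]
      exact evalOrZero_of_mem _ hR
    · rw [Polynomial.ofFn_coeff_eq_zero_of_ge _ (not_lt.mp hn),
        Polynomial.coeff_eq_zero_of_natDegree_lt (by omega), ← evalRingHom_apply, map_zero]
  have hpoly : ∀ (R : Motives.ComplexPoints Y) (hR : R.pt ∈ U) (t : ℂ),
      (Polynomial.ofFn (d + 1) (cv R)).eval t = (Pr.f.map (R.evalRingHom U hR)).eval t := by
    intro R hR t
    rw [hpolyR R hR]
  have h0 : (Polynomial.ofFn (d + 1) (cv Q)).eval t₀ = 0 := by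
    rw [hpoly Q hQU]
    exact eval_map_f_eq_zero f e halg Pr hPW
  have h1 : (Polynomial.ofFn (d + 1) (cv Q)).derivative.eval t₀ ≠ 0 := by
    rw [hpolyR Q hQU, Polynomial.derivative_map]
    exact eval_map_derivative_f_ne_zero f e halg Pr hPW
  obtain ⟨N', hN'o, hQN', hN'U, τ, hτc, hτQ, hτroot, ε, hε, hτuniq⟩ :=
    exists_continuousOn_root cv (isOpen_setOf_pt_mem U) hQU hcv h0 h1
  -- `g^{R}(τ R)` as a function of `R`, continuous on `N'`
  let gfun : Motives.ComplexPoints Y → ℂ := fun R ↦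
    ∑ i ∈ Finset.range (Pr.g.natDegree + 1), evalOrZero U (Pr.g.coeff i) R * τ R ^ i
  have hgfun : ∀ (R : Motives.ComplexPoints Y) (hR : R.pt ∈ U),
      gfun R = (Pr.g.map (R.evalRingHom U hR)).eval (τ R) := by
    intro R hR
    rw [Polynomial.eval_map, Polynomial.eval₂_eq_sum_range' (R.evalRingHom U hR)
      (Nat.lt_succ_self _)]
    simp only [gfun, evalOrZero_of_mem _ hR, evalRingHom_apply]
  have hgcont : ContinuousOn gfun N' := by
    refine continuousOn_finsetSum _ fun i _ ↦ ?_
    exact ((continuousOn_evalOrZero U _).mono hN'U).mul (hτc.pow i)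
  -- step 5: the target `N ∋ Q` of the chart
  set N : Set (Motives.ComplexPoints Y) := N' ∩ gfun ⁻¹' {0}ᶜ ∩ τ ⁻¹' Metric.ball t₀ ε with hN
  have hNo : IsOpen N := by
    refine ContinuousOn.isOpen_inter_preimage (hτc.mono inter_subset_left) ?_ Metric.isOpen_ball
    exact hgcont.isOpen_inter_preimage hN'o isOpen_compl_singleton
  have hQN : Q ∈ N := by
    refine ⟨⟨hQN', ?_⟩, ?_⟩
    · rw [mem_preimage, mem_compl_singleton_iff, hgfun Q hQU, hτQ]
      exact eval_map_g_ne_zero f e halg Pr hPW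
    · rw [mem_preimage, hτQ]
      exact Metric.mem_ball_self hε
  have hNN' : N ⊆ N' := fun R hR ↦ hR.1.1
  have hNU : ∀ R ∈ N, R.pt ∈ U := fun R hR ↦ hN'U (hNN' hR)
  -- step 4: the continuous section `σ : N → X(ℂ)` through the roots `τ`
  obtain ⟨σ, hσc, hσW, hσmap, hσx⟩ := exists_continuous_section f e halg Pr hU hW
    (fun R : N ↦ (R : Motives.ComplexPoints Y)) continuous_subtype_val (fun R ↦ hNU R R.2)
    ⟨fun R ↦ τ R, hτc.comp_continuous continuous_subtype_val fun R ↦ hNN' R.2⟩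
    (fun R ↦ by
      rw [ContinuousMap.coe_mk, ← hpoly _ (hNU R R.2)]
      exact hτroot _ (hNN' R.2))
    (fun R ↦ by
      rw [ContinuousMap.coe_mk, ← hgfun _ (hNU R R.2)]
      exact R.2.1.2)
  simp only [ContinuousMap.coe_mk] at hσx
  -- the source `O ∋ P` of the chart
  set O : Set (Motives.ComplexPoints X) :=
    {P' | P'.pt ∈ W} ∩ evalOrZero W Pr.x ⁻¹' Metric.ball t₀ ε ∩ map f ⁻¹' N with hO
  have hOo : IsOpen O :=
    ((continuousOn_evalOrZero W Pr.x).isOpen_inter_preimage (isOpen_setOf_pt_mem W)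
      Metric.isOpen_ball).inter (hNo.preimage (continuous_map f))
  have hPO : P ∈ O := by
    refine ⟨⟨hPW, ?_⟩, hQN⟩
    rw [mem_preimage, evalOrZero_of_mem _ hPW]
    exact Metric.mem_ball_self hε
  -- `σ` maps `N` into `O`
  have hσO : ∀ R : N, σ R ∈ O := by
    intro R
    refine ⟨⟨hσW R, ?_⟩, ?_⟩
    · rw [mem_preimage, evalOrZero_of_mem _ (hσW R), hσx]
      exact R.2.2
    · rw [mem_preimage, hσmap]
      exact R.2
  -- `σ (f P') = P'` on `O`: injectivity from uniqueness of the root and step 2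
  have hleft : ∀ (P' : Motives.ComplexPoints X) (hP' : P' ∈ O), σ ⟨map f P', hP'.2⟩ = P' := by
    rintro P' ⟨⟨hP'W, hP'x⟩, hP'N⟩
    refine eq_of_map_eq_of_eval_x_eq f e halg Pr hW (hσW _) hP'W (hσmap _) ?_
    rw [hσx]
    symm
    refine hτuniq (map f P') (hNN' hP'N) _ ?_ ?_
    · rw [mem_preimage, evalOrZero_of_mem _ hP'W] at hP'x
      exact hP'x
    · rw [hpoly (map f P') (e hP'W)]
      exact eval_map_f_eq_zero f e halg Pr hP'W
  -- the inverse, extended by a junk value off `N`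
  let inv : Motives.ComplexPoints Y → Motives.ComplexPoints X := fun R ↦
    if h : R ∈ N then σ ⟨R, h⟩ else P
  have hinv : ∀ (R) (h : R ∈ N), inv R = σ ⟨R, h⟩ := fun R h ↦ dif_pos h
  let E : OpenPartialHomeomorph (Motives.ComplexPoints X) (Motives.ComplexPoints Y) :=
    { toFun := map f
      invFun := inv
      source := O
      target := N
      map_source' := fun P' hP' ↦ hP'.2
      map_target' := fun R hR ↦ by rw [hinv R hR]; exact hσO ⟨R, hR⟩
      left_inv' := fun P' hP' ↦ by rw [hinv _ hP'.2]; exact hleft P' hP'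
      right_inv' := fun R hR ↦ by rw [hinv R hR]; exact hσmap ⟨R, hR⟩
      open_source := hOo
      open_target := hNo
      continuousOn_toFun := (continuous_map f).continuousOn
      continuousOn_invFun := by
        rw [continuousOn_iff_continuous_restrict]
        have hres : N.restrict inv = σ := funext fun R ↦ hinv R R.2
        rw [hres]
        exact hσc }
  exact ⟨E, hPO, fun _ _ ↦ rfl⟩

/-- **`f(ℂ)` is a local homeomorphism for `f` étale** between arbitrary `ℂ`-schemes (the strong
topology on complex points; SGA 1 XII Prop. 3.1 (iii): `f` étale ⇔ `f^an` a local isomorphism).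
[cite: SGA1, Exp. XII Prop. 3.1 (iii)] -/
theorem isLocalHomeomorph_map_of_etale [Etale f.left] :
    IsLocalHomeomorph (map f : Motives.ComplexPoints X → Motives.ComplexPoints Y) :=
  IsLocalHomeomorph.mk (map f) fun P ↦ exists_openPartialHomeomorph_eqOn_map_of_etale f P

/-- `f(ℂ)` is an open map for `f` étale. [cite: SGA1, Exp. XII Prop. 3.1 (iii)] -/
theorem isOpenMap_map_of_etale [Etale f.left] :
    IsOpenMap (map f : Motives.ComplexPoints X → Motives.ComplexPoints Y) :=
  (isLocalHomeomorph_map_of_etale f).isOpenMap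

/-- `f(ℂ)` is locally injective for `f` étale (no separatedness needed; compare
`isLocallyInjective_map_of_formallyUnramified`). [cite: SGA1, Exp. XII Prop. 3.1 (iii)] -/
theorem isLocallyInjective_map_of_etale [Etale f.left] :
    IsLocallyInjective (map f : Motives.ComplexPoints X → Motives.ComplexPoints Y) :=
  (isLocalHomeomorph_map_of_etale f).isLocallyInjective

/-! ### Finite étale morphisms give finite covering maps -/

/-- **The fibres of `f(ℂ)` are finite for `f` étale and proper** (universally closed and
quasi-compact): `f(ℂ)` is a proper local homeomorphism (`AlgPoints.isProperMap_map`).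
[cite: SGA1, Exp. XII Prop. 3.1 (iii) and Prop. 3.2 (v)–(vi)] [cite: Forster1981, §4.21] -/
theorem finite_preimage_map_singleton_of_etale [Etale f.left] [UniversallyClosed f.left]
    [QuasiCompact f.left] (t : Motives.ComplexPoints Y) :
    ((map f : Motives.ComplexPoints X → Motives.ComplexPoints Y) ⁻¹' {t}).Finite :=
  Literature.Topology.IsLocalHomeomorph.finite_preimage_singleton (isLocalHomeomorph_map_of_etale f)
    (isProperMap_map (L := ℂ) f) t

/-- **`f(ℂ)` is a covering map for `f` étale and proper** (`f` étale, universally closed and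
quasi-compact, `X` separated over `ℂ`): a proper local homeomorphism from a Hausdorff space is a
covering map. [cite: SGA1, Exp. XII Prop. 3.1 (iii) and Prop. 3.2 (v)] [cite: Forster1981, §4.22] -/
theorem isCoveringMap_map_of_etale [IsSeparated X.hom] [Etale f.left] [UniversallyClosed f.left]
    [QuasiCompact f.left] :
    IsCoveringMap (map f : Motives.ComplexPoints X → Motives.ComplexPoints Y) := by
  haveI : T2Space (Motives.ComplexPoints X) := ComplexPoints.t2Space_of_isSeparated X
  have hloc := isLocalHomeomorph_map_of_etale f
  have hprop : IsProperMap (map f : Motives.ComplexPoints X → Motives.ComplexPoints Y) :=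
    isProperMap_map (L := ℂ) f
  rw [isCoveringMap_iff_isCoveringMapOn_univ]
  exact hprop.isClosedMap.isCoveringMapOn_of_isLocalHomeomorphOn
    (fun t _ ↦ finite_preimage_map_singleton_of_etale f t) hloc.isLocalHomeomorphOn

/-- **`f(ℂ)` is a finite covering map for `f` FINITE ÉTALE** between arbitrary `ℂ`-schemes with
`X` separated over `ℂ`: the easy direction of Riemann's existence theorem («un revêtement fini
étale de `X` définit un revêtement fini de `X^an`»), without the smoothness hypotheses of
`Motives.ComplexPoints.isCoveringMap_map_of_isFinite`.
[cite: SGA1, Exp. XII Thm. 5.1 with Prop. 3.1 (iii) and Prop. 3.2 (vi)]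
[cite: Forster1981, §4.22] -/
theorem isCoveringMap_map_of_isFinite_of_etale [IsSeparated X.hom] [IsFinite f.left]
    [Etale f.left] :
    IsCoveringMap (map f : Motives.ComplexPoints X → Motives.ComplexPoints Y) ∧
      ∀ t : Motives.ComplexPoints Y,
        ((map f : Motives.ComplexPoints X → Motives.ComplexPoints Y) ⁻¹' {t}).Finite :=
  ⟨isCoveringMap_map_of_etale f, finite_preimage_map_singleton_of_etale f⟩

/-- The same over a separated BASE `Y` (then `X`, finite over `Y`, is separated over `ℂ`): the
shape in which `riemannExistence_finiteCovering` is consumed (`S` quasi-projective).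
[cite: SGA1, Exp. XII Thm. 5.1 with Prop. 3.1 (iii) and Prop. 3.2 (vi)] -/
theorem isCoveringMap_map_of_isFinite_of_etale_of_isSeparated [IsSeparated Y.hom] [IsFinite f.left]
    [Etale f.left] :
    IsCoveringMap (map f : Motives.ComplexPoints X → Motives.ComplexPoints Y) ∧
      ∀ t : Motives.ComplexPoints Y,
        ((map f : Motives.ComplexPoints X → Motives.ComplexPoints Y) ⁻¹' {t}).Finite := by
  haveI : IsSeparated X.hom := by rw [← Over.w f]; infer_instance
  exact isCoveringMap_map_of_isFinite_of_etale f

end Literature.AlgebraicGeometry.FundamentalGroup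

end
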